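import Literature.MathematicalPhysics.QuantumLattice.FockRelabel
import Literature.MathematicalPhysics.QuantumLattice.SpinTwistedHubbardTorus

/-!
# Reflection covariance of the spin-twisted Hubbard torus

(Crux `NodalDiracWeakCoupling`, line `birth`.)

Route `HubbardSuperconductivity/NodalDiracTwist`, crux stmt-HubbardSuperconductivity-10370, stub
`stub_reflCovariance` of the skeleton `Cruxes/NodalDiracWeakCoupling/Lines/birth.lean` (the `D₄`
reshape of the physics stub to a one-point form needs the covariance of the spin-twisted Hubbard
torus under the point group of the square torus).

For the axis reflection `s = DihedralGroup.sr 0` of the square torus `(ℤ/Lℤ)²`, site map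
`reflSite (x₀, x₁) = (x₀, -x₁)`, second-quantised as the Bogoliubov automorphism
`Γ_s = relabel (Orb.d4Perm s)` (`Γ_s c_{xσ} Γ_s⁻¹ = c_{s x, σ}`), the spin-twisted Hubbard torus in
the boost gauge `H_L(U, φ) = -T_L(φ) + U Σ_x n_{x↑} n_{x↓}`,
`T_L(φ) = Σ_{x,μ,σ} (e^{i(-1)^σ φ_μ/L} c†_{xσ} c_{x+e_μ,σ} + h.c.)`, satisfies

  `Γ_s H_L(U, φ) Γ_s⁻¹ = H_L(U, (φ₀, -φ₁))`   (`stub_reflCovariance`).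

Proof: the on-site interaction is a sum over sites of `n_{x↑} n_{x↓}`, reindexed by `s`
(`relabel_refl_sum_numberOp_mul_numberOp`). In the hopping term (`relabel_refl_spinTwistedHopping`)
the `e₀`-bond `(x, x + e₀)` goes to `(s x, s x + e₀)` (`refl_shift_zero`, from the tree's
`reflSite_add_single_zero`), so the `μ = 0` terms are reindexed by `s` with the same phase
(`φ'₀ = φ₀`); the `e₁`-bond `(x, x + e₁)` goes to `(s x, s x - e₁)` (`refl_shift_one`, from
`reflSite_add_single_one`), i.e. after reindexing `y = s x - e₁` it is the REVERSED `e₁`-bond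
`(y + e₁, y)`, which in `T_L` carries the conjugate phase: `φ'₁ = -φ₁`.

## References

S. Karakuzu, K. Seki, S. Sorella, Phys. Rev. B 98 (2018) 075156, Sec. II D (spin-twisted boundary
conditions and the lattice symmetries of the square Hubbard torus); D. J. Scalapino, Phys. Rep. 250
(1995) 329, §2 (the point group `C₄ᵥ ≅ D₄` of the square lattice); O. Bratteli, D. W. Robinson,
*Operator Algebras and Quantum Statistical Mechanics II* (1997) §5.2.2 (one-particle bijections as
Bogoliubov automorphisms). No new definitions, no named facts.
-/

-- the mandated namespace repeats `HubbardSuperconductivity` (single-problem summit, D-0017)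
set_option linter.dupNamespace false

noncomputable section

namespace Summit.HubbardSuperconductivity.HubbardSuperconductivity.Theorems.NodalDiracTwist

open Literature.MathematicalPhysics.QuantumLattice Literature.Probability.LatticeModels Matrix

section ReflGeometry

variable {L : ℕ} [NeZero L]

/-- The site bijection of the fermionic torus induced by `s = sr 0 ∈ D₄` is the axis reflection:
`toTorusSite (s x) = reflSite (toTorusSite x) = (x₀, -x₁)`.
Scalapino, Phys. Rep. 250 (1995) 329, §2. [folklore] -/
theorem refl_toTorusSite (x : FermionTorus 2 L) :
    FermionTorus.toTorusSite (FermionTorus.ofTorusEquiv (d4SitePerm (DihedralGroup.sr 0)) x) =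
      reflSite (FermionTorus.toTorusSite x) := by
  rw [FermionTorus.toTorusSite_ofTorusEquiv, d4SitePerm_apply]
  rfl

/-- The reflection maps the `e₀`-bond `(x, x + e₀)` to the `e₀`-bond `(s x, s x + e₀)`:
`s (x + e₀) = s x + e₀`. Scalapino, Phys. Rep. 250 (1995) 329, §2. [folklore] -/
theorem refl_shift_zero (x : FermionTorus 2 L) :
    FermionTorus.ofTorusEquiv (d4SitePerm (DihedralGroup.sr 0)) (FermionTorus.shift x 0) =
      FermionTorus.shift (FermionTorus.ofTorusEquiv (d4SitePerm (DihedralGroup.sr 0)) x) 0 := by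
  apply FermionTorus.toTorusSite_injective
  rw [refl_toTorusSite, FermionTorus.toTorusSite_shift, FermionTorus.toTorusSite_shift,
    refl_toTorusSite, reflSite_add_single_zero]

/-- The reflection REVERSES the `e₁`-bonds: `s (x + e₁) = s x - e₁`.
Scalapino, Phys. Rep. 250 (1995) 329, §2. [folklore] -/
theorem refl_shift_one (x : FermionTorus 2 L) :
    FermionTorus.ofTorusEquiv (d4SitePerm (DihedralGroup.sr 0)) (FermionTorus.shift x 1) =
      FermionTorus.unshift (FermionTorus.ofTorusEquiv (d4SitePerm (DihedralGroup.sr 0)) x) 1 := by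
  apply FermionTorus.toTorusSite_injective
  rw [refl_toTorusSite, FermionTorus.toTorusSite_shift, FermionTorus.toTorusSite_unshift,
    refl_toTorusSite, ← reflSite_add_single_one (FermionTorus.toTorusSite x), add_sub_cancel_right]

/-- The inverse of the shift permutation `x ↦ x + e_μ` is `x ↦ x - e_μ` (definitional; used to
reindex the reflected `e₁`-bonds). [folklore] -/
theorem refl_shiftEquiv_symm_apply (μ : Fin 2) (x : FermionTorus 2 L) :
    (FermionTorus.shiftEquiv μ).symm x = FermionTorus.unshift x μ :=
  rfl

end ReflGeometry

section ReflCovariance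

variable (L : ℕ) [NeZero L]

/-- **The axis reflection reverses the second spin twist of the hopping**:
`Γ_s T_L(φ₀, φ₁) Γ_s⁻¹ = T_L(φ₀, -φ₁)` for `s = sr 0`. The `e₀`-bonds are carried to `e₀`-bonds with
the same phase; the `e₁`-bond `(x, x + e₁)` is carried to `(s x, s x - e₁)`, which after the
reindexing `y = s x - e₁` is the reversed bond `(y + e₁, y)` carrying the conjugate phase
`e^{∓ i(-1)^σ φ₁/L}`. Karakuzu–Seki–Sorella, PRB 98 (2018) 075156, Sec. II D; Scalapino,
Phys. Rep. 250 (1995) 329, §2. [folklore] -/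
theorem relabel_refl_spinTwistedHopping (φ : Fin 2 → ℝ) :
    relabel (Orb.d4Perm (L := L) (DihedralGroup.sr 0)) (spinTwistedHopping L φ) =
      spinTwistedHopping L ![φ 0, -φ 1] := by
  rw [Orb.d4Perm_eq_mapEquiv]
  unfold spinTwistedHopping
  simp only [relabel_sum, relabel_add, relabel_smul, relabel_mul, relabel_creation,
    relabel_annihilation, Orb.mapEquiv_orb]
  -- expand the `μ`- and `σ`-sums, move the reflection through the shifts, evaluate the phases
  simp only [Fin.sum_univ_two, refl_shift_zero, refl_shift_one, Matrix.cons_val_zero,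
    Matrix.cons_val_one, Fin.val_zero, Fin.val_one, pow_zero, pow_one, one_mul, neg_mul, mul_neg,
    neg_div, Complex.ofReal_neg, neg_neg]
  -- split off the `e₀`-bonds (reindexed by `s`) from the `e₁`-bonds (reindexed by `x ↦ s x - e₁`)
  rw [Finset.sum_add_distrib]
  conv_rhs => rw [Finset.sum_add_distrib]
  refine congrArg₂ (· + ·) ?_ ?_
  · exact Fintype.sum_equiv (FermionTorus.ofTorusEquiv (d4SitePerm (DihedralGroup.sr 0))) _ _
      fun x => rfl
  · refine Fintype.sum_equiv ((FermionTorus.ofTorusEquiv (d4SitePerm (DihedralGroup.sr 0))).trans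
      (FermionTorus.shiftEquiv 1).symm) _ _ fun x => ?_
    simp only [Equiv.trans_apply, refl_shiftEquiv_symm_apply, FermionTorus.shift_unshift]
    abel

/-- **The on-site interaction is reflection invariant**:
`Γ_s (Σ_x n_{x↑} n_{x↓}) Γ_s⁻¹ = Σ_x n_{x↑} n_{x↓}` (`Γ_s n_{xσ} Γ_s⁻¹ = n_{s x, σ}`, and the sum over
sites is reindexed by the bijection `s`).
Scalapino, Phys. Rep. 250 (1995) 329, §2. [folklore] -/
theorem relabel_refl_sum_numberOp_mul_numberOp :
    relabel (Orb.d4Perm (L := L) (DihedralGroup.sr 0))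
        (∑ x : FermionTorus 2 L, numberOp x 0 * numberOp x 1) =
      ∑ x : FermionTorus 2 L, numberOp x 0 * numberOp x 1 := by
  rw [Orb.d4Perm_eq_mapEquiv, relabel_sum]
  simp only [relabel_mul, relabel_mapEquiv_numberOp]
  exact Fintype.sum_equiv (FermionTorus.ofTorusEquiv (d4SitePerm (DihedralGroup.sr 0))) _ _
    fun x => rfl

end ReflCovariance

/-- **Reflection covariance of the spin-twisted Hubbard torus** (stub `stub_reflCovariance` of
crux `NodalDiracWeakCoupling`, line `birth`). For the reflection `s = DihedralGroup.sr 0` (site map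
`reflSite (x₀, x₁) = (x₀, -x₁)`, second-quantised as the Bogoliubov automorphism
`relabel (Orb.d4Perm s)`, `Γ_s c_{xσ} Γ_s⁻¹ = c_{s x, σ}`):
`Γ_s H_L(U, φ) Γ_s⁻¹ = H_L(U, (φ₀, -φ₁))` — the `e₀`-bonds are mapped to `e₀`-bonds
(`reflSite_add_single_zero`, `φ'₀ = φ₀`), the `e₁`-bonds are reversed (`reflSite_add_single_one`,
`φ'₁ = -φ₁`); the interaction is reindexed.
Karakuzu–Seki–Sorella, PRB 98 (2018) 075156, Sec. II D; Scalapino, Phys. Rep. 250 (1995) 329, §2.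
[folklore] -/
theorem stub_reflCovariance (L : ℕ) [NeZero L] (U : ℝ) (φ : Fin 2 → ℝ) :
    relabel (Orb.d4Perm (L := L) (DihedralGroup.sr 0)) (spinTwistedHubbardTorus L U φ) =
      spinTwistedHubbardTorus L U ![φ 0, -φ 1] := by
  rw [spinTwistedHubbardTorus, spinTwistedHubbardTorus, neg_add_eq_sub, neg_add_eq_sub, relabel_sub,
    relabel_smul, relabel_refl_spinTwistedHopping, relabel_refl_sum_numberOp_mul_numberOp]

end Summit.HubbardSuperconductivity.HubbardSuperconductivity.Theorems.NodalDiracTwist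

end
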